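import Summits.AtomisticToContinuum.Crystallization.Theorems.OverbindingBudgetCleanlessCutDepth

/-!
# OverbindingBudget — SPACING COHERENCE (coherent cut, part 1/2: the kernels; helper `--supports stmt-31280`)

Route `OverbindingBudget` (Crystallization), crux `RobustDefectLimitWindows` (stmt-AtomisticToContinuum-31280), registered skeleton line v7
«HostedDustCut» (sha 624a0fa0…), registered residual `stub_unhostedResidual = UnhostedResidual 10`.  The landed lineage of decomp-a2c lens 4 «minimal
counterexample / extremal reduction» cut that residual exactly, twice: `UnhostedResidual 10 ⟺ CleanlessPiece 10 ∧ CleanBearingResidual 10`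
(generation 17, `Theorems/OverbindingBudgetCleanlessCut`; door side vacuous given the law `CleanlessExcess`) and `CleanBearingResidual 10 ⟺ DeepPiece 10 ∧
ShallowResidual 10` (generation 18, `Theorems/OverbindingBudgetCleanlessCutDepth`; door side vacuous given the graded law `CleanlessExcessT`).  The
declared residual `ShallowResidual 10` is a texture unhosted at radius 10 with MARGIN-UNIFORM Barlow order: at every level `t < 1/200` its `t`-robustly
clean Barlow sites are `R(t)`-dense — but the admissible spacing `a ∈ [47/50, 1]` of those sites may a priori DRIFT with the level and the place, while
the hosted door laws of line v7 (stubs 2–5: `MAT a`, `ThinCores a r`, wall tension) all live at ONE fixed spacing.  Generation 18's docstring named the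
missing step: «a SINGLE admissible spacing carrying the dense clean sites of all levels (spacing coherence: a recurrence / continuity-in-`a` lemma)».

This file (generation 19, part 1 of 2; cell critic CRITIC-LEDGER row 235, admissible move (a)) PROVES it, complete and over LANDED Theorems files only:

* §A  `CoherentAt a Y` (the spacing `a` carries `R(t)`-dense `t`-robustly clean Barlow sites at EVERY level `t < 1/200`) and the cut literal
  `CoherentBearing Y := ∃ a ∈ [47/50, 1], CoherentAt a Y`.
* §B  **K-c0 `cleanT_of_near_spacing`** (CONTINUITY OF THE ROBUST TEST IN THE SPACING): `CleanT a t Y y ∧ |a − a'| ≤ η ∧ 2η ≤ t ⟹ CleanT a' (t − 2η) Y y`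
  for admissible `a, a'` (window and gap move by `≤ (63/50)η`, the near twelve-set and the shell set are unchanged, the recentred shell rescales by `a/a'`
  and moves by `≤ (51/47)η` — landed `shellCloseTo_image`).
* §C  **K-c1 `cleanT_spread`** (MARGIN-SHARP SPREADING AT FIXED SPACING): UD ∧ two-way uniform recurrence ∧ one `t`-robustly clean site at spacing `a`
  ⟹ for every `0 ≤ t' < t` the `t'`-robustly clean sites AT SPACING `a` are within bounded distance of every site (landed `cleanT_transport` with
  `ε = min(δ/3, a(t − t')/4)`; generation 17's K3 is the case `t' = t/2`).
* §D  **K-c2 `exists_coherent_spacing`** (ONE SPACING FOR ALL LEVELS): level-wise witnesses at level-dependent spacings ⟹ one spacing `a⋆` witnessing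
  every level — `a⋆` a subsequential limit of the spacings along `t_n = 1/200 − 1/(400(n+1)) ↑ 1/200` (compactness of `[47/50, 1]`), levels lowered by K-c0.
* §E  **K-c3 `coherentBearing_of_shallow` — THE COHERENCE THEOREM: `UniformlyDiscrete Y ∧ recurrence ∧ ShallowBearing Y ⟹ CoherentBearing Y`** (K-c2
  for a witness of level `(t + 1/200)/2` at `a⋆`, K-c1 down to level `t` near every site, `ShallowBearing` for a site near every point).  K-c3′
  `coherentAt_of_tendsto`: the coherent admissible spacings form a (sequentially) CLOSED set (K-c0 alone, no recurrence); K-c3″ `exists_max_coherentAt`: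
  a coherent texture has a LARGEST coherent admissible spacing (the extremal reading; `IsClosed.csSup_mem`).

Recurrence is essential in K-c3 (two half-spaces of fcc at spacings 0.95 and 0.99 are shallow-bearing and incoherent); K-c2 and K-c3′ need none.
Part 2 (`Theorems/OverbindingBudgetCoherentCut`) cuts `ShallowResidual r₀` by excluded middle on `CoherentBearing Y`, proves the incoherent side EMPTY
outright (K-c3), and derives the residual world at the single spacing `a⋆` (dense exactly clean Barlow-close sites at every level AND torn-or-thick AT THE
SAME SPACING) — the input the fixed-spacing door laws of line v7 and the collar estimate of crux `OverbindingCap` (stmt-30249) were waiting for.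
Nothing here is registered on the line (critic waiver (w2), CRITIC-LEDGER rows 134 / 213 / 214 / 235); no statement of the route is re-typed.

Deps (tree only): `Theorems.OverbindingBudgetCleanlessCutDepth` and through it `…GradedBareness` (`ShallowBearing`, `cleanT_anti`), `…CleanlessCut`
(`margin_le_of_cleanT`), `…PatchTransport` (`cleanT_transport`, `shellCloseTo_image`), `…WallTensionLever` (`CleanT`).  No `instance`, no `notation`,
no placeholders; standard axioms only.
-/

namespace Summit.AtomisticToContinuum.Crystallization.Theorems.OverbindingBudgetSpacingCoherence

open scoped BigOperators Topology
open Literature.MathematicalPhysics.StatisticalMechanics (UniformlyDiscrete IsMuGSC lennardJones groundStateEnergy)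
open Literature.Geometry.DiscreteGeometry (ShellCloseTo fccKissingPattern hcpKissingPattern EtaMatched)
open Summit.AtomisticToContinuum.Crystallization.Theses.OverbindingBudget (RobustDefectLimitWindows)
open Summit.AtomisticToContinuum.Crystallization.Theorems.OverbindingBudgetViolatorDensityFloor (GT)
open Summit.AtomisticToContinuum.Crystallization.Theorems.OverbindingBudgetWallTensionLever (BarlowClose MAT CleanT ThinCores)
open Summit.AtomisticToContinuum.Crystallization.Theorems.OverbindingBudgetPatchTransport (cleanT_transport shellCloseTo_image)
open Summit.AtomisticToContinuum.Crystallization.Theorems.OverbindingBudgetCleanlessCut (Hosted HostedTarget UnhostedResidual CleanBearing CleanlessPiece CleanBearingResidual margin_le_of_cleanT cleanT_clean hosted_mono rdef_iff_hosted_unhosted)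
open Summit.AtomisticToContinuum.Crystallization.Theorems.OverbindingBudgetGradedBareness (CleanlessExcessT ShallowBearing cleanT_anti)
open Summit.AtomisticToContinuum.Crystallization.Theorems.OverbindingBudgetDeepBareExclusion (shallowBearing_of_graded)
open Summit.AtomisticToContinuum.Crystallization.Theorems.OverbindingBudgetCleanlessCutDepth (DeepPiece ShallowResidual cleanBearingResidual_iff_pieces deepPiece_of_graded unhostedResidual_of_graded_shallow rdef_iff_four rdef_of_hosted_graded_shallow shallowResidual_of_rdef shallowResidual_mono)

/-! ## §A  Coherence -/

/-- `CoherentAt a Y`: the single admissible spacing `a` carries, at EVERY margin level `t < 1/200`, `t`-robustly clean Barlow sites within a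
bounded distance `R(t)` of every point. -/
def CoherentAt (a : ℝ) (Y : Set (EuclideanSpace ℝ (Fin 3))) : Prop :=
  ∀ t : ℝ, 0 < t → t < 1 / 200 → ∃ R : ℝ, ∀ c : EuclideanSpace ℝ (Fin 3), ∃ y ∈ Y, dist y c ≤ R ∧ CleanT a t Y y

/-- `CoherentBearing Y` (SPACING COHERENCE): ONE admissible spacing `a ∈ [47/50, 1]` is coherent — the cut literal of this generation.  Compare the
landed `ShallowBearing Y` (generation 18), where the spacing may depend on the level `t` and on the site. -/
def CoherentBearing (Y : Set (EuclideanSpace ℝ (Fin 3))) : Prop :=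
  ∃ a : ℝ, 47 / 50 ≤ a ∧ a ≤ 1 ∧ CoherentAt a Y

/-! ## §B  Continuity of the robust test in the spacing -/

/-- **K-c0 (CONTINUITY OF `CleanT` IN THE SPACING).**  A `t`-robustly clean site at an admissible spacing `a` is `(t − 2η)`-robustly clean at every
admissible spacing `a'` with `|a − a'| ≤ η ≤ t/2`: the window `[0.98a + t, 1.26a + t]`-gap moves by at most `(63/50)η ≤ 2η`, the near twelve-set and the
shell set are unchanged (the gap `(1.02a − t, 1.26a + t)` swallows the difference), and the recentred shell is rescaled by `a/a'`, each of its points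
(norm `≤ 51/50`) moving by at most `(51/50)η/a' ≤ 2η`, so `1/5 − t`-closeness becomes `1/5 − (t − 2η)`-closeness (landed `shellCloseTo_image`). -/
theorem cleanT_of_near_spacing {a a' t η : ℝ} {Y : Set (EuclideanSpace ℝ (Fin 3))} {y : EuclideanSpace ℝ (Fin 3)}
    (ha : 47 / 50 ≤ a) (ha' : 47 / 50 ≤ a') (hη : |a - a'| ≤ η) (hηt : 2 * η ≤ t) (h : CleanT a t Y y) :
    CleanT a' (t - 2 * η) Y y := by
  have hta : t ≤ a / 50 := margin_le_of_cleanT h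
  obtain ⟨hcard, hgap, T, hT, hclose⟩ := h
  have hη0 : 0 ≤ η := (abs_nonneg _).trans hη
  have h1 : a - a' ≤ η := (le_abs_self _).trans hη
  have h2 : a' - a ≤ η := by rw [abs_sub_comm] at hη; exact (le_abs_self _).trans hη
  have hapos : 0 < a := by linarith
  have ha'pos : 0 < a' := by linarith
  have hnear : {w ∈ Y | w ≠ y ∧ dist y w ≤ a' * (1 + 1 / 50) - (t - 2 * η)} = {w ∈ Y | w ≠ y ∧ dist y w ≤ a * (1 + 1 / 50) - t} := by
    ext w
    simp only [Set.mem_setOf_eq]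
    constructor
    · rintro ⟨hw, hwy, hd⟩
      refine ⟨hw, hwy, ?_⟩
      rcases (hgap w hw hwy).2 with h3 | h3
      · exact h3
      · exfalso; linarith
    · rintro ⟨hw, hwy, hd⟩
      exact ⟨hw, hwy, by linarith⟩
  have hshell : {w ∈ Y | w ≠ y ∧ dist y w ≤ a' * (1 + 1 / 50)} = {w ∈ Y | w ≠ y ∧ dist y w ≤ a * (1 + 1 / 50)} := by
    ext w
    simp only [Set.mem_setOf_eq]
    constructor
    · rintro ⟨hw, hwy, hd⟩
      refine ⟨hw, hwy, ?_⟩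
      rcases (hgap w hw hwy).2 with h3 | h3
      · linarith
      · exfalso; linarith
    · rintro ⟨hw, hwy, hd⟩
      refine ⟨hw, hwy, ?_⟩
      rcases (hgap w hw hwy).2 with h3 | h3
      · linarith
      · exfalso; linarith
  refine ⟨?_, fun w hw hwy => ?_, ?_⟩
  · rw [hnear]; exact hcard
  · obtain ⟨hlo, hdi⟩ := hgap w hw hwy
    refine ⟨by linarith, ?_⟩
    rcases hdi with h3 | h3
    · left; linarith
    · right; linarith
  · classical
    have hq : a / a' ≠ 0 := div_ne_zero hapos.ne' ha'pos.ne'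
    refine ⟨T.image (fun x => (a / a') • x), ?_, ?_⟩
    · rw [Finset.coe_image, hT, hshell, Set.image_image]
      refine Set.image_congr' (fun w => ?_)
      show (a / a') • (a⁻¹ • (w - y)) = a'⁻¹ • (w - y)
      rw [smul_smul]
      congr 1
      field_simp
    · have hginj : Set.InjOn (fun x : EuclideanSpace ℝ (Fin 3) => (a / a') • x) (↑T : Set (EuclideanSpace ℝ (Fin 3))) :=
        fun x₁ _ x₂ _ hx => smul_right_injective (EuclideanSpace ℝ (Fin 3)) hq hx
      have hmove : ∀ x ∈ T, dist ((fun x : EuclideanSpace ℝ (Fin 3) => (a / a') • x) x) x ≤ (1 / 5 - (t - 2 * η)) - (1 / 5 - t) := by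
        intro x hx
        have hxT : (x : EuclideanSpace ℝ (Fin 3)) ∈ (↑T : Set (EuclideanSpace ℝ (Fin 3))) := hx
        rw [hT] at hxT
        obtain ⟨w, ⟨hw, hwy, hwd⟩, rfl⟩ := hxT
        have hnorm : ‖a⁻¹ • (w - y)‖ ≤ 51 / 50 := by
          rw [norm_smul, norm_inv, Real.norm_eq_abs, abs_of_pos hapos, ← dist_eq_norm, dist_comm, inv_mul_le_iff₀ hapos]
          linarith
        have hcoef : |a / a' - 1| ≤ η / a' := by
          rw [div_sub_one ha'pos.ne', abs_div, abs_of_pos ha'pos]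
          exact div_le_div_of_nonneg_right hη ha'pos.le
        have hηa : η / a' * (51 / 50) ≤ 2 * η := by
          rw [div_mul_eq_mul_div, div_le_iff₀ ha'pos]
          nlinarith
        show dist ((a / a') • (a⁻¹ • (w - y))) (a⁻¹ • (w - y)) ≤ _
        calc dist ((a / a') • (a⁻¹ • (w - y))) (a⁻¹ • (w - y))
            = ‖(a / a' - 1) • (a⁻¹ • (w - y))‖ := by rw [dist_eq_norm, sub_smul, one_smul]
          _ = |a / a' - 1| * ‖a⁻¹ • (w - y)‖ := by rw [norm_smul, Real.norm_eq_abs]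
          _ ≤ η / a' * (51 / 50) := mul_le_mul hcoef hnorm (norm_nonneg _) (by positivity)
          _ ≤ 2 * η := hηa
          _ = (1 / 5 - (t - 2 * η)) - (1 / 5 - t) := by ring
      rcases hclose with hc | hc
      · exact Or.inl (shellCloseTo_image hc hginj hmove)
      · exact Or.inr (shellCloseTo_image hc hginj hmove)

/-! ## §C  Margin-sharp spreading by recurrence -/

/-- **K-c1 (MARGIN-SHARP SPREADING AT FIXED SPACING).**  In a uniformly discrete, two-way uniformly recurrent texture ONE `t`-robustly clean Barlow site
at an admissible spacing `a` forces, for every lower level `0 ≤ t' < t`, `t'`-robustly clean Barlow sites AT THE SAME SPACING within a bounded distance of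
every site (landed `cleanT_transport` with matching error `ε = min(δ/3, a(t − t')/4)`; generation 17's K3 is the case `t' = t/2`). -/
theorem cleanT_spread {Y : Set (EuclideanSpace ℝ (Fin 3))} (hUD : UniformlyDiscrete Y)
    (hrec : (∀ R ε : ℝ, 0 < ε → ∃ L : ℝ, ∀ p ∈ Y, ∀ q ∈ Y, ∃ q' ∈ Y, dist q' q ≤ L ∧ (∀ y ∈ Y, dist y p ≤ R → ∃ y' ∈ Y, dist (y' - q') (y - p) ≤ ε) ∧ (∀ y' ∈ Y, dist y' q' ≤ R → ∃ y ∈ Y, dist (y' - q') (y - p) ≤ ε)))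
    {a t t' : ℝ} (ha1 : 47 / 50 ≤ a) (ha2 : a ≤ 1) (ht' : 0 ≤ t') (htt : t' < t) {y : EuclideanSpace ℝ (Fin 3)} (hy : y ∈ Y)
    (hc : CleanT a t Y y) : ∃ r : ℝ, ∀ q ∈ Y, ∃ y' ∈ Y, dist y' q ≤ r ∧ CleanT a t' Y y' := by
  obtain ⟨δ, hδ, hsep⟩ := id hUD
  have ha : 0 < a := by linarith
  have hta : t ≤ a / 50 := margin_le_of_cleanT hc
  set ε : ℝ := min (δ / 3) (a * (t - t') / 4) with hεdef
  have hεδ3 : ε ≤ δ / 3 := min_le_left _ _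
  have hεat : ε ≤ a * (t - t') / 4 := min_le_right _ _
  have hat : 0 < a * (t - t') := mul_pos ha (by linarith)
  have hε : 0 < ε := lt_min (by linarith) (by linarith)
  have hεδ : 2 * ε < δ := by linarith
  have hεt4 : ε ≤ (t - t') / 4 := by nlinarith
  have hεa : 100 * ε ≤ a := by nlinarith
  obtain ⟨L, hL⟩ := hrec (2 * a) ε hε
  refine ⟨L + 1, fun q hq => ?_⟩
  obtain ⟨q', hq', hdq, hex₁, hex₂⟩ := hL y hy q hq
  obtain ⟨y', hy', hyy'⟩ := hex₁ y hy (by rw [dist_self]; positivity)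
  have hd' : dist y' q' ≤ ε := by
    have h0 : y - y = 0 := sub_self y
    rw [h0, dist_zero_right, ← dist_eq_norm] at hyy'
    exact hyy'
  refine ⟨y', hy', ?_, ?_⟩
  · have := dist_triangle y' q' q
    have hε1 : ε ≤ 1 := by nlinarith
    linarith
  · exact cleanT_transport hsep hε.le hεδ hex₁ hex₂ ha hεa (by linarith) hta (by linarith) (by nlinarith) hy hy' hyy'
      (by rw [dist_self]; linarith) (Or.inl ht') hc

/-! ## §D  One spacing for all levels (compactness of the admissible interval) -/

/-- the margin levels `lvl n := 1/200 − 1/(400(n+1))`, increasing to `1/200`. -/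
noncomputable def lvl (n : ℕ) : ℝ := 1 / 200 - 1 / (400 * ((n : ℝ) + 1))

/-- the levels are positive. -/
theorem lvl_pos (n : ℕ) : 0 < lvl n := by
  unfold lvl
  have hn : (1 : ℝ) ≤ (n : ℝ) + 1 := by
    have : (0 : ℝ) ≤ n := Nat.cast_nonneg n
    linarith
  have h : 1 / (400 * ((n : ℝ) + 1)) ≤ 1 / 400 := by
    rw [div_le_div_iff₀ (by positivity) (by norm_num)]
    linarith
  linarith

/-- the levels stay below `1/200`. -/
theorem lvl_lt (n : ℕ) : lvl n < 1 / 200 := by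
  unfold lvl
  have : 0 < 1 / (400 * ((n : ℝ) + 1)) := by positivity
  linarith

/-- the levels eventually exceed `1/200 − 2η`. -/
theorem lvl_eventually_ge {η : ℝ} (hη : 0 < η) : ∃ M : ℕ, ∀ m : ℕ, M ≤ m → 1 / 200 - 2 * η ≤ lvl m := by
  obtain ⟨M, hM⟩ := exists_nat_gt (1 / (800 * η))
  refine ⟨M, fun m hm => ?_⟩
  unfold lvl
  have hmM : (M : ℝ) ≤ m := by exact_mod_cast hm
  have hpos : 0 < 400 * ((m : ℝ) + 1) := by positivity
  have hkey : 1 / (2 * η) < 400 * ((m : ℝ) + 1) := by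
    have : 1 / (2 * η) = 400 * (1 / (800 * η)) := by field_simp; ring
    rw [this]; nlinarith
  have : 1 / (400 * ((m : ℝ) + 1)) < 2 * η := by
    rw [one_div_lt hpos (by positivity)]
    exact hkey
  linarith

/-- **K-c2 (ONE SPACING FOR ALL LEVELS).**  If every level `t < 1/200` is witnessed by SOME `t`-robustly clean site at SOME admissible spacing `a(t)`, then
ONE admissible spacing `a⋆` witnesses every level: take `a⋆` a subsequential limit of `a(t_n)` along `t_n ↑ 1/200` (compactness of `[47/50, 1]`) and lower
the level of a late witness by K-c0. -/
theorem exists_coherent_spacing {Y : Set (EuclideanSpace ℝ (Fin 3))}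
    (h : ∀ t : ℝ, 0 < t → t < 1 / 200 → ∃ a : ℝ, 47 / 50 ≤ a ∧ a ≤ 1 ∧ ∃ y ∈ Y, CleanT a t Y y) :
    ∃ a : ℝ, 47 / 50 ≤ a ∧ a ≤ 1 ∧ ∀ t : ℝ, 0 < t → t < 1 / 200 → ∃ y ∈ Y, CleanT a t Y y := by
  choose! A hA1 hA2 yv hyv hcv using h
  have hmem : ∀ n : ℕ, A (lvl n) ∈ Set.Icc (47 / 50 : ℝ) 1 := fun n => ⟨hA1 _ (lvl_pos n) (lvl_lt n), hA2 _ (lvl_pos n) (lvl_lt n)⟩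
  obtain ⟨a, ha, φ, hφ, hlim⟩ := isCompact_Icc.tendsto_subseq hmem
  refine ⟨a, ha.1, ha.2, fun t ht ht' => ?_⟩
  set η : ℝ := (1 / 200 - t) / 4 with hηdef
  have hη : 0 < η := by rw [hηdef]; linarith
  obtain ⟨M, hM⟩ := lvl_eventually_ge hη
  have hev : ∀ᶠ n in Filter.atTop, dist (A (lvl (φ n))) a < η := (Metric.tendsto_nhds.1 hlim) η hη
  obtain ⟨n, hn1, hn2⟩ := (hev.and (Filter.eventually_ge_atTop M)).exists
  have hφn : M ≤ φ n := hn2.trans (hφ.id_le n)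
  have hlv : 1 / 200 - 2 * η ≤ lvl (φ n) := hM _ hφn
  have habs : |A (lvl (φ n)) - a| ≤ η := by rw [← Real.dist_eq]; exact hn1.le
  have h2η : 2 * η ≤ lvl (φ n) := by linarith
  have hc' := cleanT_of_near_spacing (hA1 _ (lvl_pos _) (lvl_lt _)) ha.1 habs h2η (hcv (lvl (φ n)) (lvl_pos _) (lvl_lt _))
  exact ⟨yv (lvl (φ n)), hyv _ (lvl_pos _) (lvl_lt _), cleanT_anti (by linarith [ha.1]) (by linarith [ha.1]) (by linarith) hc'⟩

/-! ## §E  The coherence theorem -/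

/-- **K-c3 (SPACING COHERENCE — the normal form of this generation).**  A uniformly discrete, two-way uniformly recurrent texture with MARGIN-UNIFORM
Barlow order (`ShallowBearing`, generation 18) is COHERENT: one admissible spacing `a⋆` carries `R(t)`-dense `t`-robustly clean Barlow sites at every
level `t < 1/200` (K-c2 for existence at every level at `a⋆`; K-c1 spreads a witness of the higher level `(t + 1/200)/2` down to level `t` within a
bounded distance of every site; `ShallowBearing` at level `t` supplies a site within `R_s(t)` of every point). -/
theorem coherentBearing_of_shallow {Y : Set (EuclideanSpace ℝ (Fin 3))} (hUD : UniformlyDiscrete Y)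
    (hrec : (∀ R ε : ℝ, 0 < ε → ∃ L : ℝ, ∀ p ∈ Y, ∀ q ∈ Y, ∃ q' ∈ Y, dist q' q ≤ L ∧ (∀ y ∈ Y, dist y p ≤ R → ∃ y' ∈ Y, dist (y' - q') (y - p) ≤ ε) ∧ (∀ y' ∈ Y, dist y' q' ≤ R → ∃ y ∈ Y, dist (y' - q') (y - p) ≤ ε)))
    (hs : ShallowBearing Y) : CoherentBearing Y := by
  have hlev : ∀ t : ℝ, 0 < t → t < 1 / 200 → ∃ a : ℝ, 47 / 50 ≤ a ∧ a ≤ 1 ∧ ∃ y ∈ Y, CleanT a t Y y := by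
    intro t ht ht'
    obtain ⟨R, hR⟩ := hs t ht ht'
    obtain ⟨y, hy, -, a, ha1, ha2, hc⟩ := hR 0
    exact ⟨a, ha1, ha2, y, hy, hc⟩
  obtain ⟨a, ha1, ha2, hall⟩ := exists_coherent_spacing hlev
  refine ⟨a, ha1, ha2, fun t ht ht' => ?_⟩
  obtain ⟨y₀, hy₀, hc₀⟩ := hall ((t + 1 / 200) / 2) (by linarith) (by linarith)
  obtain ⟨r, hr⟩ := cleanT_spread hUD hrec ha1 ha2 ht.le (by linarith) hy₀ hc₀
  obtain ⟨R, hR⟩ := hs t ht ht'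
  refine ⟨R + r, fun c => ?_⟩
  obtain ⟨q, hq, hqc, -⟩ := hR c
  obtain ⟨y', hy', hd, hc'⟩ := hr q hq
  refine ⟨y', hy', ?_, hc'⟩
  have := dist_triangle y' q c
  linarith

/-- **K-c3′ (sequential closedness of the coherent spacings — the extremal reading).**  A limit of coherent admissible spacings is coherent (K-c0 at
level `(t + 1/200)/2`, no recurrence needed); hence a coherent texture has a LARGEST and a SMALLEST coherent admissible spacing (K-c3″). -/
theorem coherentAt_of_tendsto {Y : Set (EuclideanSpace ℝ (Fin 3))} {A : ℕ → ℝ} {a : ℝ}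
    (hmem : ∀ n : ℕ, 47 / 50 ≤ A n) (hcoh : ∀ n : ℕ, CoherentAt (A n) Y) (ha : 47 / 50 ≤ a)
    (hlim : Filter.Tendsto A Filter.atTop (nhds a)) : CoherentAt a Y := by
  intro t ht ht'
  set η : ℝ := (1 / 200 - t) / 4 with hηdef
  have hη : 0 < η := by rw [hηdef]; linarith
  have hev : ∀ᶠ n in Filter.atTop, dist (A n) a < η := (Metric.tendsto_nhds.1 hlim) η hη
  obtain ⟨n, hn⟩ := hev.exists
  have habs : |A n - a| ≤ η := by rw [← Real.dist_eq]; exact hn.le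
  obtain ⟨R, hR⟩ := hcoh n (t + 2 * η) (by linarith) (by rw [hηdef]; linarith)
  refine ⟨R, fun c => ?_⟩
  obtain ⟨y, hy, hd, hc⟩ := hR c
  have hc' := cleanT_of_near_spacing (hmem n) ha habs (by linarith) hc
  refine ⟨y, hy, hd, ?_⟩
  have : t + 2 * η - 2 * η = t := by ring
  rw [this] at hc'
  exact hc'

/-- **K-c3″ (THE LARGEST COHERENT SPACING).**  A coherent texture has a largest coherent admissible spacing (the coherent admissible spacings form a
nonempty closed bounded set, K-c3′; `IsClosed.csSup_mem`). -/
theorem exists_max_coherentAt {Y : Set (EuclideanSpace ℝ (Fin 3))} (h : CoherentBearing Y) :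
    ∃ a : ℝ, 47 / 50 ≤ a ∧ a ≤ 1 ∧ CoherentAt a Y ∧ ∀ b : ℝ, 47 / 50 ≤ b → b ≤ 1 → CoherentAt b Y → b ≤ a := by
  set S : Set ℝ := {b : ℝ | 47 / 50 ≤ b ∧ b ≤ 1 ∧ CoherentAt b Y} with hSdef
  obtain ⟨a₀, ha₀1, ha₀2, hcoh₀⟩ := h
  have hne : S.Nonempty := ⟨a₀, ha₀1, ha₀2, hcoh₀⟩
  have hbdd : BddAbove S := ⟨1, fun b hb => hb.2.1⟩
  have hclosed : IsClosed S := by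
    refine IsSeqClosed.isClosed (fun A a hA hlim => ?_)
    have h1 : 47 / 50 ≤ a := ge_of_tendsto' hlim (fun n => (hA n).1)
    have h2 : a ≤ 1 := le_of_tendsto' hlim (fun n => (hA n).2.1)
    exact ⟨h1, h2, coherentAt_of_tendsto (fun n => (hA n).1) (fun n => (hA n).2.2) h1 hlim⟩
  have hmem : sSup S ∈ S := hclosed.csSup_mem hne hbdd
  exact ⟨sSup S, hmem.1, hmem.2.1, hmem.2.2, fun b hb1 hb2 hb => le_csSup hbdd ⟨hb1, hb2, hb⟩⟩

end Summit.AtomisticToContinuum.Crystallization.Theorems.OverbindingBudgetSpacingCoherence
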